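import Mathlib
import Literature.NumberTheory.Transcendental.LindemannWeierstrassProofs
import Literature.NumberTheory.Transcendental.TranscendentalSpecialization
import Summits.Schanuel.Schanuel.Theorems.RigidCoreSchanuelOnLogFreeCoreExpExceptionalLine

/-!
# Line `sector-split` of crux `RigidCore.SchanuelOnLogFreeCore`: the exceptional-line dichotomy
# for a general transcendental anchor

Crux `stmt-Schanuel-0970` (`Summit.Schanuel.Schanuel.Theses.RigidCore.SchanuelOnLogFreeCore`,
Schanuel's conjecture on the log-free core), line `sector-split` (skeleton v6), registered
calibration stub `stub_exceptionalLineDichotomy`, which is VERBATIM item `stmt-Schanuel-9552`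
(`Summit.Schanuel.Schanuel.Theses.ExceptionalSubspaces.ExceptionalLineDichotomy`): for a
transcendental anchor `η ∈ ℂ` and `ℚ`-linearly independent algebraic `α, β`, at least one of the
pairs `(η, e^α)`, `(η, e^β)` is algebraically independent over `ℚ` — the exceptional exponents
`{α ∈ ℚ̄ : η ∈ ℚ(e^α)^alg}` of an anchor span at most ONE `ℚ`-line (the dimension-one case of
`ExceptionalSubspacesIntersect`).

Proof.  By Lindemann–Weierstrass (PROVED tree theorem
`Literature.NumberTheory.Transcendental.algebraicIndependent_exp_holds`; A. Baker,
*Transcendental Number Theory* (1975), Ch. 1 §3, remark after Theorem 1.4; on a pair: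
`ExpExceptionalLine.algebraicIndependent_exp_pair` of the sibling file
`…Theorems.RigidCoreSchanuelOnLogFreeCoreExpExceptionalLine`, imported) `x = e^α`, `y = e^β`
are algebraically independent over `ℚ`.  The rest is the exchange property of algebraic
dependence in `ℂ/ℚ` (`LineDichotomy.algebraicIndependent_pair_or`): if both pairs `(η, x)`,
`(η, y)` were algebraically dependent then, `η` being transcendental, `y` is algebraic over
`ℚ[η]`, and, `x` being transcendental, `η` is algebraic over `ℚ[x]`
(`isAlgebraic_adjoin_of_not_algebraicIndependent` of
`Literature.NumberTheory.Transcendental.TranscendentalSpecialization`, from Mathlib's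
`AlgebraicIndependent.iff_transcendental_adjoin_image`); by transitivity
(`IsAlgebraic.adjoin_of_forall_isAlgebraic`) `y` is algebraic over `ℚ[x]`, contradicting
`x ⊥ y`.  Equivalently: `trdeg ℚ(η, x, y) = trdeg ℚ(η) ≤ 1 < 2 = trdeg ℚ(x, y)`.  This is the
argument of `KernelTower.algebraicIndependent_pi_exp_or` of
`…Theorems.RigidCoreSchanuelOnLogFreeCoreExpExceptionalLine` (anchor `η = π`, via Lindemann) for
an arbitrary transcendental anchor; nothing about `π` is used.  No `Theses` module is
imported here; the literal match
`example : ExceptionalSubspaces.ExceptionalLineDichotomy := stub_exceptionalLineDichotomy` is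
checked in the line's skeleton, which imports
`Summits.Schanuel.Schanuel.Theses.ExceptionalSubspaces`.

## Main statements (namespace `Summit.Schanuel.Schanuel.Theorems.RigidCore`)

* `LineDichotomy.algebraicIndependent_pair_or` — the matroid fact: `η` transcendental and
  `x ⊥ y` imply `η ⊥ x ∨ η ⊥ y`;
* `LineDichotomy.transcendental_adjoin_of_algebraicIndependent_pair` — `η ⊥ x` gives `x`
  transcendental over `ℚ(η)` and `η` transcendental over `ℚ(x)`;
* `stub_exceptionalLineDichotomy` — the registered stub (= item stmt-Schanuel-9552 verbatim);
* `KernelTower.not_isAlgebraic_adjoin_anchor_exp_pair` — `e^α, e^β` are not both algebraic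
  over `ℚ(η)`;
* `KernelTower.not_isAlgebraic_anchor_adjoin_exp_pair` — `η` is not algebraic over both
  `ℚ(e^α)` and `ℚ(e^β)` ("at most one exceptional `ℚ`-line");
* `KernelTower.not_linearIndependent_of_not_algebraicIndependent_anchor` — algebraic `α, β`
  whose exponentials are both algebraically dependent on `η` are `ℚ`-linearly dependent.

NOT here: which line (if any) is exceptional — for `η = π` the line `ℚ·1` is `e ⊥ π`, open; the
neighbouring stubs of the line (`stub_piFreeOnAxes`, `stub_coreRelSchanuelOverPiLWField`,
`stub_exceptionalSubspacesIntersect`, `stub_piFree_of_piFreeOnAxes`, `stub_exactness`,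
`stub_axesSplitExact`) are neither proved nor used.

## References

* [BakerTNT1975] A. Baker, *Transcendental Number Theory*, Cambridge University Press (1975),
  Ch. 1 §3, Theorem 1.4 and the remark following it (Lindemann–Weierstrass), p. 6.
-/

noncomputable section

-- `Summit.Schanuel.Schanuel.…` is the D-0017 single-problem layout
set_option linter.dupNamespace false

namespace Summit.Schanuel.Schanuel.Theorems.RigidCore

open Literature.NumberTheory.Transcendental
open Literature.NumberTheory.Transcendental.Specialization

namespace LineDichotomy

/-! ## Pairs in the algebraic matroid of `ℂ/ℚ` -/

/-- **A transcendental point against an independent pair.** If `η` is transcendental and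
`x, y` are algebraically independent over `ℚ`, then `η ⊥ x` or `η ⊥ y`: otherwise `y` is
algebraic over `ℚ[η]` and (exchange, `x` being transcendental) `η` is algebraic over `ℚ[x]`,
whence `y` is algebraic over `ℚ[x]`, contradicting `x ⊥ y`. [folklore] -/
theorem algebraicIndependent_pair_or {η x y : ℂ} (hη : Transcendental ℚ η)
    (hxy : AlgebraicIndependent ℚ ![x, y]) :
    AlgebraicIndependent ℚ ![η, x] ∨ AlgebraicIndependent ℚ ![η, y] := by
  by_contra h
  obtain ⟨h1, h2⟩ := not_or.mp h
  -- `x` is transcendental (a member of an algebraically independent family)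
  have hxt : Transcendental ℚ x := hxy.transcendental 0
  -- `η` is algebraic over `ℚ[x]`: the pair `(x, η)` is dependent and `x` is transcendental
  have hηx : IsAlgebraic (Algebra.adjoin ℚ ({x} : Set ℂ)) η :=
    isAlgebraic_adjoin_of_not_algebraicIndependent hxt (not_algebraicIndependent_swap h1)
  -- `y` is algebraic over `ℚ[η]`
  have hyη : IsAlgebraic (Algebra.adjoin ℚ ({η} : Set ℂ)) y :=
    isAlgebraic_adjoin_of_not_algebraicIndependent hη h2
  -- hence `y` is algebraic over `ℚ[x]`
  have hyx : IsAlgebraic (Algebra.adjoin ℚ ({x} : Set ℂ)) y :=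
    IsAlgebraic.adjoin_of_forall_isAlgebraic (s := ({η} : Set ℂ)) (t := ({x} : Set ℂ))
      (fun z hz => by
        obtain ⟨hz, -⟩ := hz
        rw [Set.mem_singleton_iff] at hz
        subst hz
        exact hηx) hyη
  -- contradicting `x ⊥ y`
  have hty : Transcendental (Algebra.adjoin ℚ ({x} : Set ℂ)) y := by
    have ht := hxy.transcendental_adjoin (s := {0}) (i := 1) (by simp)
    have hs : ((![x, y]) '' ({0} : Set (Fin 2))) = {x} := by simp
    rw [hs] at ht
    simpa using ht
  exact hty hyx

/-- If `η ⊥ x` then `x` is transcendental over `ℚ(η)` and `η` is transcendental over `ℚ(x)`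
(`AlgebraicIndependent.transcendental_adjoin`). [folklore] -/
theorem transcendental_adjoin_of_algebraicIndependent_pair {η x : ℂ}
    (h : AlgebraicIndependent ℚ ![η, x]) :
    Transcendental (IntermediateField.adjoin ℚ ({η} : Set ℂ)) x ∧
      Transcendental (IntermediateField.adjoin ℚ ({x} : Set ℂ)) η := by
  constructor
  · have ht := h.transcendental_adjoin (s := {0}) (i := 1) (by simp)
    have hs : ((![η, x]) '' ({0} : Set (Fin 2))) = {η} := by simp
    rw [hs] at ht
    rw [IntermediateField.transcendental_adjoin_iff]
    simpa using ht
  · have ht := h.transcendental_adjoin (s := {1}) (i := 0) (by simp)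
    have hs : ((![η, x]) '' ({1} : Set (Fin 2))) = {x} := by simp
    rw [hs] at ht
    rw [IntermediateField.transcendental_adjoin_iff]
    simpa using ht

end LineDichotomy

open LineDichotomy ExpExceptionalLine

/-! ## The dichotomy -/

/-- **Stub `stub_exceptionalLineDichotomy` of line `sector-split`** (registered signature; item
stmt-Schanuel-9552 `ExceptionalSubspaces.ExceptionalLineDichotomy` verbatim): for a transcendental
anchor `η` and `ℚ`-linearly independent algebraic `α, β`, at least one of the pairs `(η, e^α)`,
`(η, e^β)` is algebraically independent over `ℚ` (Lindemann–Weierstrass: `e^α ⊥ e^β`,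
`ExpExceptionalLine.algebraicIndependent_exp_pair`; then the exchange property,
`LineDichotomy.algebraicIndependent_pair_or`).  At `η = π`: at least one of
`e ⊥ π`, `π ⊥ e^{√2}`; at least one of `e ⊥ π`, `π ⊥ e^{i}`. [cite: BakerTNT1975, Ch. 1 Thm 1.4] -/
theorem stub_exceptionalLineDichotomy :
    ∀ η α β : ℂ, Transcendental ℚ η → IsAlgebraic ℚ α → IsAlgebraic ℚ β →
      LinearIndependent ℚ ![α, β] →
      AlgebraicIndependent ℚ ![η, Complex.exp α] ∨ AlgebraicIndependent ℚ ![η, Complex.exp β] :=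
  fun _η _α _β hη hα hβ hli =>
    algebraicIndependent_pair_or hη (algebraicIndependent_exp_pair hα hβ hli)

/-- **`e^α, e^β` are not both algebraic over `ℚ(η)`** for a transcendental anchor `η` and
`ℚ`-linearly independent algebraic `α, β`. [cite: BakerTNT1975, Ch. 1 Thm 1.4] -/
theorem KernelTower.not_isAlgebraic_adjoin_anchor_exp_pair (η α β : ℂ) (hη : Transcendental ℚ η)
    (hα : IsAlgebraic ℚ α) (hβ : IsAlgebraic ℚ β) (hli : LinearIndependent ℚ ![α, β]) :
    ¬ (IsAlgebraic (IntermediateField.adjoin ℚ ({η} : Set ℂ)) (Complex.exp α) ∧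
        IsAlgebraic (IntermediateField.adjoin ℚ ({η} : Set ℂ)) (Complex.exp β)) := by
  rintro ⟨ha, hb⟩
  rcases stub_exceptionalLineDichotomy η α β hη hα hβ hli with h | h
  · exact (transcendental_adjoin_of_algebraicIndependent_pair h).1 ha
  · exact (transcendental_adjoin_of_algebraicIndependent_pair h).1 hb

/-- **At most one exceptional `ℚ`-line**: a transcendental anchor `η` is not algebraic over
both `ℚ(e^α)` and `ℚ(e^β)` when `α, β` are `ℚ`-linearly independent algebraic numbers.
[cite: BakerTNT1975, Ch. 1 Thm 1.4] -/
theorem KernelTower.not_isAlgebraic_anchor_adjoin_exp_pair (η α β : ℂ) (hη : Transcendental ℚ η)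
    (hα : IsAlgebraic ℚ α) (hβ : IsAlgebraic ℚ β) (hli : LinearIndependent ℚ ![α, β]) :
    ¬ (IsAlgebraic (IntermediateField.adjoin ℚ ({Complex.exp α} : Set ℂ)) η ∧
        IsAlgebraic (IntermediateField.adjoin ℚ ({Complex.exp β} : Set ℂ)) η) := by
  rintro ⟨ha, hb⟩
  rcases stub_exceptionalLineDichotomy η α β hη hα hβ hli with h | h
  · exact (transcendental_adjoin_of_algebraicIndependent_pair h).2 ha
  · exact (transcendental_adjoin_of_algebraicIndependent_pair h).2 hb

/-- **Exceptional exponents are `ℚ`-linearly dependent**: algebraic `α, β` with both pairs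
`(η, e^α)`, `(η, e^β)` algebraically dependent (`η` transcendental) are `ℚ`-linearly dependent.
[cite: BakerTNT1975, Ch. 1 Thm 1.4] -/
theorem KernelTower.not_linearIndependent_of_not_algebraicIndependent_anchor (η α β : ℂ)
    (hη : Transcendental ℚ η) (hα : IsAlgebraic ℚ α) (hβ : IsAlgebraic ℚ β)
    (ha : ¬ AlgebraicIndependent ℚ ![η, Complex.exp α])
    (hb : ¬ AlgebraicIndependent ℚ ![η, Complex.exp β]) : ¬ LinearIndependent ℚ ![α, β] :=
  fun hli => (stub_exceptionalLineDichotomy η α β hη hα hβ hli).elim ha hb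

end Summit.Schanuel.Schanuel.Theorems.RigidCore
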